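import Summits.ResolutionOfSingularities.ResolutionOfSingularities.Theorems.UniversalCellsCampaignW82RegularTwistCriterion
import Literature.AlgebraicGeometry.Motives.FrobeniusEtale
import Literature.AlgebraicGeometry.Resolution.KunzRegularityCriterionProofs
import Literature.AlgebraicGeometry.Morphisms.FlatOfComp
import Literature.AlgebraicGeometry.Resolution.AlterationsDescentStage
import HarnessLib

/-!
# [OURS · L1 W8.2] The KUNZ FORM of the regular-twist criterion: a variety over `M(t)` (`M` perfect) is smooth
# iff its RELATIVE FROBENIUS `F_{Y/K} : Y → Y^{(p)}` is FLAT; over any field, `F_{Y/K}` flat iff `Y^{(p)}` regular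

Cell `res-hironaka` (run/shared/lean/pub/res-hironaka/), LADDER-RESOLUTION rung L (RESCUE), slot W8.2; host route
`UniversalCells`, host item `PrimeFieldToPerfect` (stmt-ResolutionOfSingularities-15233), door 1. Theses-free
proofs file, written by res-L1-s82-pv-1 (gen 5): form (E4) of Cruxes/PrimeFieldToPerfect/KERNEL.md §2 made a kernel
statement, from Kunz's theorem (PROVED in the tree: `Literature…Resolution.Kunz1969_holds`,
`flat_frobenius_of_isRegularLocalRing`, `Kunz1969.isRegularLocalRing_of_flat_frobenius`), the relative Frobenius
of `Literature…Motives.FrobeniusEtale` (`relativeFrobenius`, surjective), flatness descent along a flat surjection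
(`Literature…Morphisms.Flat.of_comp_of_surjective`, Stacks 02JZ) and the criterion `smooth_iff_isRegular_frobeniusTwist`
(…RegularTwistCriterion, (E3)).

* `stalkMap_absoluteFrobenius_apply`, `flat_absoluteFrobenius_iff_isRegular` — **Kunz's theorem for schemes**: for
  a locally Noetherian scheme `X` with `p = 0` in `Γ(X, 𝒪_X)`, the absolute Frobenius `F_X` is FLAT iff `X` is
  REGULAR (stalkwise `F_X` is the Frobenius of `𝒪_{X,x}`; Kunz 1969 Thm. 2.1).
* `fst_comp_relativeFrobenius` — `pr₁ ≫ F_{Y/X} = F_{Y^{(p)}}` (`Y^{(p)} = Y ×_{X,F_X} X`): with `F_{Y/X} ≫ pr₁ = F_Y`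
  the two factorisations of the absolute Frobenii through the relative one.
* **`flat_relativeFrobenius_iff_isRegular_twist`** — over ANY field `K` of characteristic `p`, for `q : Y → Spec K`
  locally of finite type (so `Y`, `Y^{(p)}` are locally Noetherian): `F_{Y/K}` is flat iff the Frobenius twist
  `Y^{(p)}` is regular. (⇒: `F_Y = F_{Y/K} ≫ pr₁` is flat, so `Y` is regular by Kunz, and regularity descends along
  the flat surjective `F_{Y/K}`; ⇐: `F_{Y^{(p)}} = pr₁ ≫ F_{Y/K}` is flat by Kunz and `pr₁` is flat surjective, so
  `F_{Y/K}` is flat by Stacks 02JZ.) In particular either condition forces `Y` regular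
  (`isRegular_of_flat_relativeFrobenius`).
* **`smooth_iff_flat_relativeFrobenius`** — over `K = M(t)`, `M` PERFECT, `q` of finite type: `Smooth q ↔ Flat F_{Y/K}`
  ((E3) ∘ the previous item; `absoluteFrobenius (Spec K) = Spec Frob_K`).

HONEST FRAMING. OURS theorems (role replaced: §17 ¶2 p.89 l.59–62 of [Hironaka2017], typed AS PRINTED as
`S17Methodology.U89_3`); NOT statements of the manuscript; nothing attributed to its author; a normal form of the
slot's residual condition («the resolution's relative Frobenius is flat»), not progress on the open residual. AI work,
weaker than expert review; no claim beyond the kernel.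
-/

noncomputable section

set_option linter.dupNamespace false -- mandated namespace of this single-conjunct summit

open CategoryTheory CategoryTheory.Limits AlgebraicGeometry TopologicalSpace
open Literature.AlgebraicGeometry.Resolution Literature.AlgebraicGeometry.Motives

namespace Summit.ResolutionOfSingularities.ResolutionOfSingularities.Theorems.CampaignW82

/-! ## Kunz's theorem for schemes: `F_X` flat iff `X` regular -/

section Kunz

variable (p : ℕ) [Fact p.Prime] {X : Scheme.{0}} (hX : (p : Γ(X, ⊤)) = 0)

include hX in
/-- The local rings of a scheme with `p = 0` in `Γ(X, 𝒪_X)` have characteristic `p`. [folklore] -/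
theorem charP_stalk (x : X) : CharP (X.presheaf.stalk x) p := by
  refine (CharP.charP_iff_prime_eq_zero (Fact.out : p.Prime)).mpr ?_
  have h := congrArg (X.presheaf.germ ⊤ x trivial).hom hX
  simpa using h

/-- **The absolute Frobenius is the Frobenius on every local ring**: `(F_X)_x (g) = g ^ p` for `g ∈ 𝒪_{X,x}`
(germs: `F_X^*(s) = s ^ p` on sections). [cite: Hartshorne1977, IV §2 (Definition of the Frobenius morphism, before Rem. 2.4.1)] -/
theorem stalkMap_absoluteFrobenius_apply (x : X) (g : X.presheaf.stalk x) :
    ((absoluteFrobenius X p hX).stalkMap x).hom g = g ^ p := by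
  obtain ⟨U, hxU, s, rfl⟩ := TopCat.Presheaf.exists_germ_eq X.presheaf g
  have h := Scheme.Hom.germ_stalkMap_apply (absoluteFrobenius X p hX) U x hxU s
  rw [absoluteFrobenius_app_apply] at h
  have h2 : (X.presheaf.germ U x hxU).hom (s ^ p) = ((X.presheaf.germ U x hxU).hom s) ^ p :=
    map_pow _ s p
  exact h.trans h2

/-- The stalk map of the absolute Frobenius IS `frobenius 𝒪_{X,x} p`. [folklore] -/
theorem stalkMap_absoluteFrobenius_eq (x : X) :
    haveI := charP_stalk p hX x
    ((absoluteFrobenius X p hX).stalkMap x).hom = frobenius (X.presheaf.stalk x) p := by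
  refine RingHom.ext fun g => ?_
  change _ = g ^ p
  exact stalkMap_absoluteFrobenius_apply p hX x g

/-- **KUNZ'S THEOREM FOR SCHEMES** (Kunz 1969, Thm. 2.1; Stacks 0EC0): for a locally Noetherian scheme `X` with
`p = 0` in `Γ(X, 𝒪_X)`, the absolute Frobenius `F_X : X → X` is FLAT iff `X` is REGULAR — stalkwise Kunz's criterion
(`Kunz1969_holds`, proved in the tree) for the Frobenius of `𝒪_{X,x}`. [cite: Kunz1969, Thm. 2.1] -/
theorem flat_absoluteFrobenius_iff_isRegular [IsLocallyNoetherian X] :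
    Flat (absoluteFrobenius X p hX) ↔ Scheme.IsRegular X := by
  constructor
  · intro hF x
    haveI := charP_stalk p hX x
    have h1 : ((absoluteFrobenius X p hX).stalkMap x).hom.Flat := Flat.stalkMap _ x
    rw [stalkMap_absoluteFrobenius_eq p hX x] at h1
    exact Kunz1969.isRegularLocalRing_of_flat_frobenius p (X.presheaf.stalk x) h1
  · intro hreg
    refine Flat.of_stalkMap _ fun x => ?_
    haveI := charP_stalk p hX x
    haveI : IsRegularLocalRing (X.presheaf.stalk x) := hreg x
    rw [stalkMap_absoluteFrobenius_eq p hX x]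
    exact flat_frobenius_of_isRegularLocalRing p (X.presheaf.stalk x)

/-- The absolute Frobenius is surjective (it is the identity on points). [folklore] -/
theorem surjective_absoluteFrobenius : Surjective (absoluteFrobenius X p hX) :=
  ⟨fun x => ⟨x, rfl⟩⟩

end Kunz

/-! ## The relative Frobenius and the twist: `pr₁ ≫ F_{Y/X} = F_{Y^{(p)}}` -/

section Relative

variable (p : ℕ) [Fact p.Prime] {Y X : Scheme.{0}} (hX : (p : Γ(X, ⊤)) = 0) (q : Y ⟶ X)

/-- **`pr₁ ≫ F_{Y/X} = F_{Y^{(p)}}`**: the absolute Frobenius of the twist `Y^{(p)} = Y ×_{X,F_X} X` factors as the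
projection to `Y` followed by the relative Frobenius (both components agree: `F_{Y/X} ≫ pr₁ = F_Y` and
`pr₁ ≫ F_Y = F_{Y^{(p)}} ≫ pr₁`; `F_{Y/X} ≫ pr₂ = q` and `pr₁ ≫ q = pr₂ ≫ F_X = F_{Y^{(p)}} ≫ pr₂`).
[cite: Hartshorne1977, IV Rem. 2.4.1] -/
theorem fst_comp_relativeFrobenius :
    pullback.fst q (absoluteFrobenius X p hX) ≫ relativeFrobenius p hX q =
      absoluteFrobenius (pullback q (absoluteFrobenius X p hX)) p
        (natCast_eq_zero_of_hom p (pullback.snd q (absoluteFrobenius X p hX)) hX) := by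
  apply pullback.hom_ext
  · rw [Category.assoc, relativeFrobenius_fst, absoluteFrobenius_comp p (pullback.fst q _)]
  · rw [Category.assoc, relativeFrobenius_snd, pullback.condition,
      absoluteFrobenius_comp p (pullback.snd q _)]

/-- **`F_{Y/X}` FLAT ⟺ `Y^{(p)}` REGULAR** whenever `Y` and `Y^{(p)}` are locally Noetherian (e.g. `q` locally of
finite type over a field). ⇒: `F_Y = F_{Y/X} ≫ pr₁` is flat (`pr₁` is a base change of the flat `F_X` — here we ASSUME
`F_X` flat, i.e. `X` regular, e.g. `X = Spec K`), so `Y` is regular (Kunz) and regularity descends along the flat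
surjective `F_{Y/X}` (Matsumura 23.7). ⇐: `F_{Y^{(p)}} = pr₁ ≫ F_{Y/X}` is flat (Kunz) and `pr₁` is flat and
surjective, so `F_{Y/X}` is flat (Stacks 02JZ). [cite: Kunz1969, Thm. 2.1] -/
theorem flat_relativeFrobenius_iff_isRegular_pullback [IsLocallyNoetherian Y]
    [IsLocallyNoetherian (pullback q (absoluteFrobenius X p hX))] [Flat (absoluteFrobenius X p hX)] :
    Flat (relativeFrobenius p hX q) ↔ Scheme.IsRegular (pullback q (absoluteFrobenius X p hX)) := by
  have hY : (p : Γ(Y, ⊤)) = 0 := natCast_eq_zero_of_hom p q hX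
  haveI : Surjective (absoluteFrobenius X p hX) := surjective_absoluteFrobenius p hX
  haveI : Flat (pullback.fst q (absoluteFrobenius X p hX)) := MorphismProperty.pullback_fst _ _ ‹_›
  haveI : Surjective (pullback.fst q (absoluteFrobenius X p hX)) := MorphismProperty.pullback_fst _ _ ‹_›
  constructor
  · intro hF
    -- `F_Y = F_{Y/X} ≫ pr₁` is flat, so `Y` is regular
    have hFY : Flat (absoluteFrobenius Y p hY) := by
      rw [← relativeFrobenius_fst p hX q]; infer_instance
    have hYreg : Scheme.IsRegular Y := (flat_absoluteFrobenius_iff_isRegular p hY).mp hFY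
    haveI : Surjective (relativeFrobenius p hX q) := surjective_relativeFrobenius p hX q
    exact DeJong1996.Stage.isRegular_of_flat_surjective (relativeFrobenius p hX q) hYreg
  · intro hreg
    have hFp : Flat (absoluteFrobenius (pullback q (absoluteFrobenius X p hX)) p
        (natCast_eq_zero_of_hom p (pullback.snd q (absoluteFrobenius X p hX)) hX)) :=
      (flat_absoluteFrobenius_iff_isRegular p _).mpr hreg
    haveI : Flat (pullback.fst q (absoluteFrobenius X p hX) ≫ relativeFrobenius p hX q) := by
      rw [fst_comp_relativeFrobenius]; exact hFp
    exact Literature.AlgebraicGeometry.Morphisms.Flat.of_comp_of_surjective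
      (pullback.fst q (absoluteFrobenius X p hX)) (relativeFrobenius p hX q)

end Relative

/-! ## Over a field: `F_{Y/K}` flat ⟺ `Y^{(p)}` regular; over `M(t)`, `M` perfect: ⟺ `Y` smooth -/

section Field

variable (p : ℕ) [Fact p.Prime] (K : Type) [Field K] [CharP K p]

omit [Fact p.Prime] in
/-- `p = 0` in `Γ(Spec K, 𝒪)` for a field (ring) `K` of characteristic `p`. [folklore] -/
theorem natCast_sections_Spec_eq_zero : (p : Γ(Spec (.of K), ⊤)) = 0 := by
  have h : (Scheme.ΓSpecIso (.of K)).inv.hom (p : K) = (p : Γ(Spec (.of K), ⊤)) := map_natCast _ p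
  rw [← h, CharP.cast_eq_zero, map_zero]

/-- The absolute Frobenius of `Spec K` is `Spec` of `frobenius K p`. [folklore] -/
theorem absoluteFrobenius_Spec_eq (hK : (p : Γ(Spec (.of K), ⊤)) = 0) :
    absoluteFrobenius (Spec (.of K)) p hK = Spec.map (CommRingCat.ofHom (frobenius K p)) := by
  rw [absoluteFrobenius_Spec]
  exact congrArg (fun φ : K →+* K => Spec.map (CommRingCat.ofHom φ)) (RingHom.ext fun a => rfl)

variable {Y : Scheme.{0}} (q : Y ⟶ Spec (.of K))

/-- **Over any field `K` of characteristic `p`: the relative Frobenius `F_{Y/K} : Y → Y^{(p)}` of a `K`-scheme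
locally of finite type is FLAT iff the Frobenius twist `Y^{(p)} = Y ×_{K,Frob} K` is REGULAR.**
[cite: Kunz1969, Thm. 2.1] -/
theorem flat_relativeFrobenius_iff_isRegular_twist [LocallyOfFiniteType q]
    (hK : (p : Γ(Spec (.of K), ⊤)) = 0) :
    Flat (relativeFrobenius p hK q) ↔
      Scheme.IsRegular (pullback q (Spec.map (CommRingCat.ofHom (frobenius K p)))) := by
  have hF := absoluteFrobenius_Spec_eq p K hK
  haveI : Flat (absoluteFrobenius (Spec (.of K)) p hK) := by
    rw [hF]; exact DeJong1996.Stage.flat_specMap _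
  haveI : IsLocallyNoetherian Y := LocallyOfFiniteType.isLocallyNoetherian q
  haveI : LocallyOfFiniteType (pullback.snd q (absoluteFrobenius (Spec (.of K)) p hK)) :=
    MorphismProperty.pullback_snd _ _ ‹_›
  haveI : IsLocallyNoetherian (pullback q (absoluteFrobenius (Spec (.of K)) p hK)) :=
    LocallyOfFiniteType.isLocallyNoetherian (pullback.snd q (absoluteFrobenius (Spec (.of K)) p hK))
  rw [flat_relativeFrobenius_iff_isRegular_pullback p hK q]
  -- the twist along `F_{Spec K}` is the twist along `Spec Frob_K`
  constructor
  · intro h; rw [hF] at h; exact h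
  · intro h; rw [hF]; exact h

/-- Either side of `flat_relativeFrobenius_iff_isRegular_twist` forces `Y` itself regular (`F_Y = F_{Y/K} ≫ pr₁`
flat, Kunz). [cite: Kunz1969, Thm. 2.1] -/
theorem isRegular_of_flat_relativeFrobenius [LocallyOfFiniteType q] (hK : (p : Γ(Spec (.of K), ⊤)) = 0)
    [Flat (relativeFrobenius p hK q)] : Scheme.IsRegular Y := by
  have hF := absoluteFrobenius_Spec_eq p K hK
  haveI : Flat (absoluteFrobenius (Spec (.of K)) p hK) := by
    rw [hF]; exact DeJong1996.Stage.flat_specMap _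
  haveI : Flat (pullback.fst q (absoluteFrobenius (Spec (.of K)) p hK)) :=
    MorphismProperty.pullback_fst _ _ ‹_›
  haveI : IsLocallyNoetherian Y := LocallyOfFiniteType.isLocallyNoetherian q
  have hFY : Flat (absoluteFrobenius Y p (natCast_eq_zero_of_hom p q hK)) := by
    rw [← relativeFrobenius_fst p hK q]; infer_instance
  exact (flat_absoluteFrobenius_iff_isRegular p _).mp hFY

/-- **THE KUNZ FORM OF THE REGULAR-TWIST CRITERION (KERNEL.md §2 (E4)).** Over `K = M(t)` with `M` PERFECT of
characteristic `p`, for `q : Y → Spec K` of finite type: `q` is SMOOTH iff the relative Frobenius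
`F_{Y/K} : Y → Y^{(p)}` is FLAT (`smooth_iff_isRegular_frobeniusTwist` ∘ `flat_relativeFrobenius_iff_isRegular_twist`).
So the W8.2 residual asks, equivalently, for a level `e` and a resolution `Y → X₀^{(p^e)}` WHOSE RELATIVE FROBENIUS
OVER `M(t)` IS FLAT. [cite: Kunz1969, Thm. 2.1] -/
theorem smooth_iff_flat_relativeFrobenius (M : Type) [Field M] [CharP M p] [PerfectField M] {Y : Scheme.{0}}
    (q : Y ⟶ Spec (.of (RatFunc M))) [LocallyOfFiniteType q] [QuasiCompact q]
    (hK : (p : Γ(Spec (.of (RatFunc M)), ⊤)) = 0) :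
    Smooth q ↔ Flat (relativeFrobenius p hK q) := by
  rw [flat_relativeFrobenius_iff_isRegular_twist p (RatFunc M) q hK]
  exact smooth_iff_isRegular_frobeniusTwist M q

/-- The same with the canonical witness of `p = 0` on `Spec M(t)`. [cite: Kunz1969, Thm. 2.1] -/
theorem smooth_iff_flat_relativeFrobenius' (M : Type) [Field M] [CharP M p] [PerfectField M] {Y : Scheme.{0}}
    (q : Y ⟶ Spec (.of (RatFunc M))) [LocallyOfFiniteType q] [QuasiCompact q] :
    Smooth q ↔ Flat (relativeFrobenius p (natCast_sections_Spec_eq_zero p (RatFunc M)) q) :=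
  smooth_iff_flat_relativeFrobenius p M q _

end Field

end Summit.ResolutionOfSingularities.ResolutionOfSingularities.Theorems.CampaignW82

end
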